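import Mathlib
import Summits.NavierStokesRegularity.NavierStokesRegularity.Theorems.LerayQuarterDissipationFiniteDissipationLiouvilleLambProductCollar
import HarnessLib

/-!
# Crux `FiniteDissipationLiouville` (stmt-NavierStokesRegularity-22144): THE ENDPOINT SCHEME NEAR THE
# APEX — a hypothesis holding only on a final time interval `(τ, 0)` already forbids the apex
# singularity (zoom-IN version of the antitone-enstrophy scheme)

Theorems file of route `LerayQuarterDissipation` (lead prover g18; `--supports` the crux; sequel of
`…EndpointScheme(Slack)` and `…LambProductCollar`). Navier–Stokes regularity is NOT proved by anything
here; no summit is.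

`…EndpointScheme.eq_zero_of_antitone_scheme` zooms OUT: a hypothesis valid at ALL times makes the
global similarity enstrophy antitone on `ℝ`, and the far-past limit carries constant enstrophy. For a
REGULARITY CRITERION one wants hypotheses near the (potential) singular time only. This file runs the
same argument toward the apex:

* `tendsto_atTop_of_antitoneOn_Ici` — an antitone-on-`[s₀, ∞)` function bounded below converges at `+∞`;
* **`not_singular_of_apex_scheme`** — THE APEX SCHEME: let `P τ` (`τ < 0`) be a family of properties
  («the hypothesis holds on `[τ, 0)`») with (i) `P τ V → P (τ/c²) V_c` under parabolic rescalings,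
  (ii) EVENTUAL closedness: if `u_j → W` as in `…Compactness.seqLimit` with `P (τ_j) (u_j)`,
  `τ_j → −∞`, then `W` has the all-time property `P∞`, (iii) `P τ V` makes the global similarity
  enstrophy of an enveloped member antitone on `[−log(−τ), ∞)`, (iv) `P∞` + constant enstrophy kills
  an enveloped member. Then NO KNSS-gauge Type-I field with a Type-I envelope (constants equalised)
  satisfying `P τ` for some `τ < 0` is singular at the apex: its zoom-IN limit along scales `e^{−j}`
  (KNSS compactness) has the all-time property and constant enstrophy `= lim_{s→∞} Z_V(s)`, hence
  vanishes, while it is singular by persistence (one law for the enveloped class,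
  `…LambProduct.exists_uniform_law_of_envelope`) — contradiction.

HONEST FRAMING. Bookkeeping (g17's argument, zoom-in instead of zoom-out) about HYPOTHETICAL objects;
the conclusion is «not singular at the apex», not `V ≡ 0` (the hypothesis says nothing about the
past). Nothing is removed from the catalogued DSS wall by itself. Nothing here bears on NS regularity.

References: Koch–Nadirashvili–Seregin–Šverák, Acta Math. 203 (2009) §4 (compactness, persistence);
folklore energy method.
-/

noncomputable section

set_option linter.dupNamespace false

namespace Summit.NavierStokesRegularity.NavierStokesRegularity.Theorems.FiniteDissipationLiouville.EndpointScheme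

open MeasureTheory Set Filter Topology Metric InnerProductSpace Function Real
open scoped RealInnerProductSpace ContDiff
open Literature.Analysis Literature.Analysis.FluidPDE
open Summit.NavierStokesRegularity.NavierStokesRegularity.Theorems
open Summit.NavierStokesRegularity.NavierStokesRegularity.Theorems.GaussianGap
open Summit.NavierStokesRegularity.NavierStokesRegularity.Theorems.SimilarityEnstrophy
open Summit.NavierStokesRegularity.NavierStokesRegularity.Theorems.RecurrentReductionD
open Summit.NavierStokesRegularity.NavierStokesRegularity.Theorems.FiniteDissipationLiouville
open Summit.NavierStokesRegularity.NavierStokesRegularity.Theorems.FiniteDissipationLiouville.CrossFlow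
open Summit.NavierStokesRegularity.NavierStokesRegularity.Theorems.FiniteDissipationLiouville.LambProduct

/-- An antitone-on-`[s₀, ∞)` real function bounded below there converges at `+∞`. [folklore] -/
theorem tendsto_atTop_of_antitoneOn_Ici {Z : ℝ → ℝ} {s₀ b : ℝ} (hanti : AntitoneOn Z (Ici s₀))
    (hb : ∀ s, s₀ ≤ s → b ≤ Z s) :
    ∃ m : ℝ, Tendsto Z atTop (𝓝 m) ∧ ∀ s, s₀ ≤ s → m ≤ Z s := by
  set f : ℝ → ℝ := fun σ => Z (max σ s₀) with hf
  have hfanti : Antitone f := by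
    intro σ σ' h
    exact hanti (le_max_right σ s₀) (le_max_right σ' s₀) (max_le_max h le_rfl)
  have hbdd : BddBelow (range f) := ⟨b, by rintro _ ⟨σ, rfl⟩; exact hb _ (le_max_right _ _)⟩
  refine ⟨⨅ σ, f σ, ?_, fun s hs => ?_⟩
  · have h := tendsto_atTop_ciInf hfanti hbdd
    refine h.congr' ?_
    filter_upwards [eventually_ge_atTop s₀] with σ hσ
    rw [hf]; dsimp only; rw [max_eq_left hσ]
  · have : f s = Z s := by rw [hf]; dsimp only; rw [max_eq_left hs]
    rw [← this]; exact ciInf_le hbdd s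

variable {C : ℝ}

/-- **THE APEX SCHEME.** See the module docstring. `P : ℝ → (field → Prop)` is the time-restricted
family, `Pinf` the all-time property. [folklore energy method + KNSS compactness] -/
theorem not_singular_of_apex_scheme
    {P : ℝ → (ℝ → EuclideanSpace ℝ (Fin 3) → EuclideanSpace ℝ (Fin 3)) → Prop}
    {Pinf : (ℝ → EuclideanSpace ℝ (Fin 3) → EuclideanSpace ℝ (Fin 3)) → Prop}
    (hscale : ∀ (V : ℝ → EuclideanSpace ℝ (Fin 3) → EuclideanSpace ℝ (Fin 3)) (c τ : ℝ), 0 < c →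
      P τ V → P (τ / c ^ 2) (nsRescale c V))
    (hclosed : ∀ (u : ℕ → ℝ → EuclideanSpace ℝ (Fin 3) → EuclideanSpace ℝ (Fin 3))
        (W : ℝ → EuclideanSpace ℝ (Fin 3) → EuclideanSpace ℝ (Fin 3)) (τ : ℕ → ℝ),
      (∀ j, IsTypeIAncientMild C (u j)) → (∀ j, HasTypeIDecay C (u j)) → (∀ j, P (τ j) (u j)) →
      Tendsto τ atTop atBot → IsTypeIAncientMild C W →
      (∀ n : ℕ, TendstoUniformlyOn (fun j z => u j z.1 z.2) (fun z => W z.1 z.2) atTop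
        (Icc (-((n : ℝ) + 2)) (-(1 / ((n : ℝ) + 2))) ×ˢ
          closedBall (0 : EuclideanSpace ℝ (Fin 3)) ((n : ℝ) + 2))) →
      (∀ t < 0, ∀ x, Tendsto (fun j => u j t x) atTop (𝓝 (W t x))) →
      (∀ t < 0, ∀ x, Tendsto (fun j => fderiv ℝ (u j t) x) atTop (𝓝 (fderiv ℝ (W t) x))) →
      Pinf W)
    (hanti : ∀ (V : ℝ → EuclideanSpace ℝ (Fin 3) → EuclideanSpace ℝ (Fin 3)) (τ : ℝ),
      IsTypeIAncientMild C V → HasTypeIDecay C V → τ < 0 → P τ V →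
      AntitoneOn (fun σ => ∫ y, ‖lerayVorticity V σ y‖ ^ 2) (Ici (-Real.log (-τ))))
    (hconst : ∀ (V : ℝ → EuclideanSpace ℝ (Fin 3) → EuclideanSpace ℝ (Fin 3)),
      IsTypeIAncientMild C V → HasTypeIDecay C V → Pinf V →
      (∀ s s' : ℝ, (∫ y, ‖lerayVorticity V s y‖ ^ 2) = ∫ y, ‖lerayVorticity V s' y‖ ^ 2) →
      ∀ t < 0, ∀ x, V t x = 0)
    {V : ℝ → EuclideanSpace ℝ (Fin 3) → EuclideanSpace ℝ (Fin 3)}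
    (hV : IsTypeIAncientMild C V) (hdec : HasTypeIDecay C V) {τ : ℝ} (hτ : τ < 0) (hP : P τ V) :
    ¬ (∀ r > 0, ∀ M : ℝ, ∃ t ∈ Ioo (-(r ^ 2)) (0 : ℝ),
      ∃ x ∈ ball (0 : EuclideanSpace ℝ (Fin 3)) r, M < ‖V t x‖) := by
  intro hsing
  obtain ⟨C₁, C₂, C₃, hD1, hD2, -⟩ := IsTypeIAncientMild.gaugeBounds_of_hasTypeIDecay hV hdec
  -- the enstrophy: antitone on `[s₀, ∞)`, nonnegative, hence convergent at `+∞`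
  obtain ⟨Z, hZdef⟩ : ∃ Z : ℝ → ℝ, Z = fun σ => ∫ y, ‖lerayVorticity V σ y‖ ^ 2 := ⟨_, rfl⟩
  have hZσ : ∀ σ, Z σ = ∫ y, ‖lerayVorticity V σ y‖ ^ 2 := fun σ => by rw [hZdef]
  set s₀ : ℝ := -Real.log (-τ) with hs₀
  have hantiZ : AntitoneOn Z (Ici s₀) := by rw [hZdef]; exact hanti V τ hV hdec hτ hP
  have hZ0 : ∀ σ, 0 ≤ Z σ := fun σ => by rw [hZσ]; exact integral_nonneg fun y => sq_nonneg _
  obtain ⟨m, hm, hmle⟩ := tendsto_atTop_of_antitoneOn_Ici hantiZ (b := 0) fun s _ => hZ0 s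
  -- the zoom-IN sequence, its law, its singularity, its KNSS limit
  obtain ⟨u, hudef⟩ : ∃ u : ℕ → ℝ → EuclideanSpace ℝ (Fin 3) → EuclideanSpace ℝ (Fin 3),
      ∀ j, u j = nsRescale (Real.exp (-(j : ℝ))) V := ⟨_, fun j => rfl⟩
  have hu : ∀ j, IsTypeIAncientMild C (u j) := fun j => by
    rw [hudef]; exact hV.nsRescale (Real.exp_pos _)
  have hdu : ∀ j, HasTypeIDecay C (u j) := fun j => by
    rw [hudef]; exact hdec.nsRescale (Real.exp_pos _)
  have hPu : ∀ j : ℕ, P (τ / Real.exp (-(j : ℝ)) ^ 2) (u j) := fun j => by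
    rw [hudef]; exact hscale V _ τ (Real.exp_pos _) hP
  have hsu : ∀ j, ∀ r > 0, ∀ M : ℝ, ∃ t ∈ Ioo (-(r ^ 2)) (0 : ℝ),
      ∃ x ∈ ball (0 : EuclideanSpace ℝ (Fin 3)) r, M < ‖u j t x‖ := fun j => by
    rw [hudef]; exact singularAtOrigin_nsRescale hsing (Real.exp_pos _)
  obtain ⟨K, hK⟩ := exists_uniform_law_of_envelope C
  have hlaw : ∀ j, ∀ s : ℝ, s < 0 →
      ∫⁻ x, ‖fderiv ℝ (u j s) x‖ₑ ^ 2 ≤ ENNReal.ofReal (K / Real.sqrt (-s)) := fun j => hK (hu j) (hdu j)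
  obtain ⟨ψ, hψ, W, hW, hunif, hpt, hgr⟩ := Compactness.seqLimit hu
  have hψt : Tendsto ψ atTop atTop := hψ.tendsto_atTop
  have hψr : Tendsto (fun j => ((ψ j : ℕ) : ℝ)) atTop atTop := tendsto_natCast_atTop_atTop.comp hψt
  have hdW : HasTypeIDecay C W := fun t ht x =>
    le_of_tendsto (hpt t ht x).norm (Eventually.of_forall fun j => hdu (ψ j) t ht x)
  have hWsing := Compactness.persistent_singularity_seq (w := fun j => u (ψ j))
    (fun j => hu _) (fun j => hlaw _) (fun j => hsu _) hW hunif
  -- the thresholds `τ e^{2ψ_j}` recede to `−∞`, so the limit has the all-time property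
  have hτj : Tendsto (fun j => τ / Real.exp (-((ψ j : ℕ) : ℝ)) ^ 2) atTop atBot := by
    have e : ∀ j, τ / Real.exp (-((ψ j : ℕ) : ℝ)) ^ 2 = τ * Real.exp (2 * ((ψ j : ℕ) : ℝ)) := by
      intro j
      rw [div_eq_mul_inv, ← Real.exp_nat_mul, ← Real.exp_neg]
      congr 1; push_cast; ring_nf
    simp_rw [e]
    have h2 : Tendsto (fun j => Real.exp (2 * ((ψ j : ℕ) : ℝ))) atTop atTop :=
      Real.tendsto_exp_atTop.comp (hψr.const_mul_atTop (by norm_num))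
    exact h2.const_mul_atTop_of_neg hτ
  have hPW : Pinf W := hclosed (fun j => u (ψ j)) W (fun j => τ / Real.exp (-((ψ j : ℕ) : ℝ)) ^ 2)
    (fun j => hu _) (fun j => hdu _) (fun j => hPu _) hτj hW hunif hpt hgr
  -- every slice enstrophy of `W` equals `m`
  have hZW : ∀ σ : ℝ, (∫ y, ‖lerayVorticity W σ y‖ ^ 2) = m := by
    intro σ
    obtain ⟨c, hcdef⟩ : ∃ c : ℝ, c = Real.exp (-σ / 2) := ⟨_, rfl⟩
    have hc : 0 < c := by rw [hcdef]; exact Real.exp_pos _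
    have hlogc : 2 * Real.log c = -σ := by rw [hcdef, Real.log_exp]; ring
    have hc2 : c ^ 2 * (-1) < 0 := by
      have : 0 < c ^ 2 := by positivity
      linarith
    obtain ⟨u', hu'def⟩ : ∃ u' : ℕ → ℝ → EuclideanSpace ℝ (Fin 3) → EuclideanSpace ℝ (Fin 3),
        ∀ j, u' j = nsRescale c (u (ψ j)) := ⟨_, fun j => rfl⟩
    have hu' : ∀ j, IsTypeIAncientMild C (u' j) := fun j => by
      rw [hu'def]; exact (hu (ψ j)).nsRescale hc
    have hdu' : ∀ j, HasTypeIDecay C (u' j) := fun j => by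
      rw [hu'def]; exact (hdu (ψ j)).nsRescale hc
    have hgr' : ∀ x, Tendsto (fun j => fderiv ℝ (u' j (-1)) x) atTop
        (𝓝 (fderiv ℝ (nsRescale c W (-1)) x)) := by
      intro x
      simp only [hu'def, fderiv_nsRescale]
      exact (hgr _ hc2 (c • x)).const_smul (c * c)
    have hlim := tendsto_integral_sq_norm_curl_neg_one hu' hdu' hgr'
    have e1 : ∀ j, (∫ x, ‖curl (u' j (-1)) x‖ ^ 2) = Z (σ + 2 * ((ψ j : ℕ) : ℝ)) := by
      intro j
      rw [← enstrophy_zero_eq, hu'def, enstrophy_nsRescale hc, hudef,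
        enstrophy_nsRescale (Real.exp_pos _), Real.log_exp, hlogc, hZσ]
      congr 2
      ring
    have e2 : (∫ x, ‖curl (nsRescale c W (-1)) x‖ ^ 2) = ∫ y, ‖lerayVorticity W σ y‖ ^ 2 := by
      rw [← enstrophy_zero_eq, enstrophy_nsRescale hc, hlogc, zero_sub, neg_neg]
    rw [e2] at hlim
    simp_rw [e1] at hlim
    have harg : Tendsto (fun j => σ + 2 * ((ψ j : ℕ) : ℝ)) atTop atTop :=
      tendsto_atTop_add_const_left atTop σ (hψr.const_mul_atTop (by norm_num))
    exact tendsto_nhds_unique hlim (hm.comp harg)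
  -- so the limit vanishes; but it is singular
  have hW0 : ∀ t < 0, ∀ x, W t x = 0 := hconst W hW hdW hPW fun s s' => by rw [hZW s, hZW s']
  obtain ⟨t, ht, x, -, hM⟩ := hWsing 1 one_pos 0
  rw [hW0 t ht.2 x, norm_zero] at hM
  exact lt_irrefl _ hM

end Summit.NavierStokesRegularity.NavierStokesRegularity.Theorems.FiniteDissipationLiouville.EndpointScheme

end
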